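import Summits.BirchSwinnertonDyer.BirchSwinnertonDyer.Theses.AdditiveKolyvaginRoad
import Summits.BirchSwinnertonDyer.BirchSwinnertonDyer.Theorems.AdditiveKolyvaginRoadKolyvaginPrimitiveAdditiveRankLowering
import Summits.BirchSwinnertonDyer.BirchSwinnertonDyer.Theorems.AdditiveKolyvaginRoadKolyvaginPrimitiveAdditiveInduction
import Summits.BirchSwinnertonDyer.BirchSwinnertonDyer.Theorems.AdditiveKolyvaginRoadKolyvaginSupplyOfPoitouTate
import Summits.BirchSwinnertonDyer.BirchSwinnertonDyer.Theorems.AdditiveKolyvaginRoadKolyvaginPrimitiveAdditiveParityOfLevelInputs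
import Summits.BirchSwinnertonDyer.BirchSwinnertonDyer.Theorems.AdditiveKolyvaginRoadKolyvaginPrimitiveOfLevelSystems
import Summits.BirchSwinnertonDyer.BirchSwinnertonDyer.Theorems.AdditiveKolyvaginRoadLevelSystemsBottom
import Summits.BirchSwinnertonDyer.BirchSwinnertonDyer.Theorems.AdditiveKolyvaginRoadTwoPrimeJump
import HarnessLib

/-!
# Route `AdditiveKolyvaginRoad`, crux `KolyvaginPrimitiveAdditive` (item stmt-BirchSwinnertonDyer-21400): THE BOT′-FREE
# E-SIDE COMPOSITION — published inputs + published duality inputs + LEVEL SYSTEMS (KS′) ⟹ Kolyvagin's conjecture mod `p`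
# at an additive prime, WITHOUT the bottom crux BOT′ (skeleton v10 of line `birth`, lead prover `bsd-wall-akr-p1` g5)
# (cell `pub/bsd-wall`; `--supports stmt-BirchSwinnertonDyer-21400`)

WHAT. `kolyvaginPrimitiveAdditive_of_published_of_levelSystems : PublishedInputsAdditiveKoly →
PublishedDualityInputsAdditiveKoly → LevelKolyvaginSystemsAdditive → KolyvaginPrimitiveAdditive` — the composition
`KolyvaginPrimitiveAdditive_of` of the registered skeleton v10 with every stub discharged or granted BY NAME: parity P from PUB
+ DUAL.1 (`oddSelmerRankAdditive_of_levelInputs`, p557719); `s = 1`: akr-p2x's «the bottom is inside the level system»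
(`kolyvaginPrimitive_of_levelSystem_of_rankOne`, p567709) fed with KS′ and the two-prime jump J2 FROM DUAL.2 = Poitou–Tate
(`twoPrimeJump_of_poitouTate`, this lineage) — NO `BottomRankOneAdditive`; `s ≥ 3`: complex conjugation `c ≠ 1`, the
`ZMod p`-structures, A1 (`stub_rankLoweringAdditive`, p521749), KS′, LOC from DUAL.2 (`kolyvaginLocalPackageP_of_poitouTate`,
p562934) and the ENGINE (`stub_inductionOfLevelSystemsAdditive`, p534939) — this branch is akr-p1 g4's
`kolyvaginPrimitiveAdditive_of_levelSystems_of_discr_lt` with its `hBOT` binder unused, re-assembled here. CONSEQUENCE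
(planner's pen, tenure desk rule 2026-08-27T20:12:53Z (b)): the route's `closes` no longer needs the binder `hBOT`; crux r2
`KolyvaginPrimitiveAdditive` ⟸ PUB ∧ DUAL ∧ KS′ by kernel; BOT′ (21397) becomes a corollary of KS′.

HONEST FRAMING: theorems only; 0 definitions, 0 named facts, 0 `sorry`; PUB, DUAL are the published inputs (hypotheses),
KS′ is the open promoted crux (hypothesis); nothing about them is asserted. BSD is not proved by any of this.

References: [cite: WZhang2014, §9 proof of Thm. 9.1, Thm. 9.2, Thm. 4.3, Lemma 5.3, Thm. 7.2, Lemma 8.2]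
[cite: GrossLMS1991, §4, Prop. 2.3] [cite: MilneADT2006, Ch. I, Thm. 4.10] [cite: McCallumLMS1991, Prop. 2.1].
-/

-- single-conjunct summit: `Summit.BirchSwinnertonDyer.BirchSwinnertonDyer.…` repeats the name by design
set_option linter.dupNamespace false

noncomputable section

open scoped Classical

namespace Summit.BirchSwinnertonDyer.BirchSwinnertonDyer.Theorems.AdditiveKoly

open WeierstrassCurve NumberField IsDedekindDomain Field Literature.NumberTheory.EllipticCurves
  Literature.NumberTheory.EllipticCurves.ModularForms
  Literature.NumberTheory.EllipticCurves.Rank1Residual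
  Literature.NumberTheory.GaloisRepresentations
  Summit.BirchSwinnertonDyer.Rank1Residual Module
open Summit.BirchSwinnertonDyer.BirchSwinnertonDyer.Theses.AdditiveKolyvaginRoad

/-- **The BOT′-free E-side composition at the frames with `d_K < −4`**: granted the published inputs
`PublishedInputsAdditiveKoly`, the published duality inputs `PublishedDualityInputsAdditiveKoly` (levelwise Cassels–Tate,
Poitou–Tate for Selmer structures) and the level systems `LevelKolyvaginSystemsAdditive` (KS′), every ♯ additive frame with
`d_K < −4` has a Kolyvagin–Heegner datum of Kolyvagin-prime support with `c(1) ≠ 0` in `H¹(K, E[p])`. Parity P ∕ A1 ∕ LOC ∕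
ENGINE ∕ J2 are tree theorems (this lineage), the rank-one case is p567709 (akr-p2x); KS′ is the one open crux.
[cite: WZhang2014, §9 proof of Thm. 9.1, Thm. 9.2, Lemma 5.3, Thm. 7.2, Lemma 8.2] [cite: GrossLMS1991, §4, Prop. 2.3] -/
theorem kolyvaginPrimitiveAdditive_of_levelSystems (hPUB : PublishedInputsAdditiveKoly)
    (hDual : PublishedDualityInputsAdditiveKoly) (hKS : LevelKolyvaginSystemsAdditive) :
    ∀ (W : WeierstrassCurve ℚ) [W.IsElliptic] [W.IsGloballyMinimal] [NeZero (W.conductorNorm ℤ)]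
      (p : ℕ) [Fact p.Prime] (K : Type) [Field K] [NumberField K]
      (Dt : ModularParametrizationData W (W.conductorNorm ℤ)) (β : ℤ) (ι : K →+* ℂ),
      5 ≤ p → Addv W p → W.HasSurjectiveModNGaloisRep p →
      (∀ (ℓ : ℕ) [Fact ℓ.Prime], W.HasMultiplicativeReductionAtPrime ℓ →
        ¬ p ∣ padicValInt ℓ W.minimalDiscriminantInt) →
      (∃ (ℓ₁ ℓ₂ : ℕ) (_ : Fact ℓ₁.Prime) (_ : Fact ℓ₂.Prime), ℓ₁ ≠ ℓ₂ ∧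
        W.HasMultiplicativeReductionAtPrime ℓ₁ ∧ W.HasMultiplicativeReductionAtPrime ℓ₂) →
      ¬ p ∣ W.tamagawaProduct → W.analyticRank = 1 →
      IsImaginaryQuadratic K → Odd (NumberField.discr K) → NumberField.discr K < -4 →
      SatisfiesHeegnerHypothesis (W.conductorNorm ℤ) K →
      (W.quadraticTwist (NumberField.discr K : ℚ)).entireLFunction 1 ≠ 0 →
      (4 * (W.conductorNorm ℤ : ℤ)) ∣ β ^ 2 - NumberField.discr K → ¬ (p : ℤ) ∣ Dt.c →
      ∃ (n : ℕ) (d : KolyvaginHeegnerData Dt β ι n),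
        KolyvaginDescent.KolSupp (Zhang2014.IsKolyvaginPrime (W.conductorNorm ℤ) W K p) n ∧
          d.kolyvaginClass (Fact.out : p.Prime) 1 ≠ 0 := by
  intro W _ _ _ p _ K _ _ Dt β ι h5 hadd hsurj hsp1 hsp2 htam hr1 hK hodd hd hHH hL hβ hc
  have hp : p.Prime := Fact.out
  obtain ⟨s, hsodd, hs⟩ := oddSelmerRankAdditive_of_levelInputs hPUB.1 hPUB.2.1 hPUB.2.2.2.2.1 hDual.1 W p K Dt β ι
    h5 hadd hsurj hsp1 hsp2 htam hr1 hK hodd hHH hL hβ hc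
  by_cases h1 : s = 1
  · -- the bottom is inside the level system (akr-p2x p567709): KS′ + the two-prime jump J2 from DUAL.2
    subst h1
    rw [pow_one] at hs
    obtain ⟨c, hc1⟩ := exists_algEquiv_ne_one_of_isImaginaryQuadratic K hK
    letI : Module (ZMod p) (Vp W K p) :=
      AddCommGroup.zmodModule (fun x ↦ by
        have h := zsmul_discreteH1_torsion ((p ^ 1 : ℕ) : ℤ) x
        rw [← natCast_zsmul]
        convert h using 2
        push_cast
        ring)
    obtain ⟨S⟩ := hKS W p K Dt β ι h5 hadd hsurj hsp1 hsp2 htam hr1 hK hodd hd hHH hL hβ hc c hc1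
    exact kolyvaginPrimitive_of_levelSystem_of_rankOne W K p c Dt β ι h5 hadd hsurj hK hHH hc1
      (twoPrimeJump_of_poitouTate W K p c h5 hK hc1 (hDual.2 K)) S hs
  · -- Selmer rank odd and `≠ 1`, hence `≥ 3`: Zhang's induction above the bottom
    have h3 : 3 ≤ s := by
      obtain ⟨k, hk⟩ := hsodd
      omega
    have hp2 : p ≠ 2 := by omega
    obtain ⟨c, hc1⟩ := exists_algEquiv_ne_one_of_isImaginaryQuadratic K hK
    -- the unique `ZMod p`-module structures on `H¹(K, E[p])` and on the `H¹(K_v, E[p])`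
    letI : Module (ZMod p) (Vp W K p) :=
      AddCommGroup.zmodModule (fun x ↦ by
        have h := zsmul_discreteH1_torsion ((p ^ 1 : ℕ) : ℤ) x
        rw [← natCast_zsmul]
        convert h using 2
        push_cast
        ring)
    letI : ∀ v : Place K, Module (ZMod p)
        (galoisCohomology (((W.baseChange K).torsionGaloisModule ((p ^ 1 : ℕ) : ℤ)).toLocal v) 1) := fun v ↦
      AddCommGroup.zmodModule (fun x ↦ by
        have h := galoisCohomology.nsmul_eq_zero_of_forall
          (((W.baseChange K).torsionGaloisModule ((p ^ 1 : ℕ) : ℤ)).toLocal v) (n := p ^ 1)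
          (fun m => AddSubgroup.torsionBy.nsmul m) x
        simpa using h)
    -- cup products need compact absolute Galois groups; `E[p](K̄)` is finite
    haveI : NeZero (p ^ 1 : ℕ) := ⟨pow_ne_zero 1 hp.ne_zero⟩
    haveI : ∀ v : Place K, CompactSpace (absoluteGaloisGroup (Place.Completion v)) := fun v ↦
      absoluteGaloisGroup_compactSpace _
    haveI : Finite (geomTorsion (W.baseChange K) ((p ^ 1 : ℕ) : ℤ)) :=
      finite_geomTorsion_of_neZero (W.baseChange K) (p ^ 1)
    have hA1 := stub_rankLoweringAdditive W p K Dt β ι h5 hadd hsurj hsp1 hsp2 htam hr1 hK hodd hHH hL hβ hc c hc1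
    obtain ⟨S⟩ := hKS W p K Dt β ι h5 hadd hsurj hsp1 hsp2 htam hr1 hK hodd hd hHH hL hβ hc c hc1
    obtain ⟨L⟩ := kolyvaginLocalPackageP_of_poitouTate W K p ι c hK hp2 hd hsurj hc1 (hDual.2 K)
    exact stub_inductionOfLevelSystemsAdditive W p K Dt β ι h5 hadd hsurj hsp1 hsp2 htam hr1 hK hodd hHH hL hβ hc c
      hc1 hA1 S L s hsodd h3 hs

/-- **THE BOT′-FREE GLUE, by name**: `PublishedInputsAdditiveKoly → PublishedDualityInputsAdditiveKoly →
LevelKolyvaginSystemsAdditive → KolyvaginPrimitiveAdditive` (crux r2 ⟸ PUB ∧ DUAL ∧ KS′; the binder `hBOT` of the route's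
`closes` is no longer needed). [cite: WZhang2014, §9 proof of Thm. 9.1, Thm. 9.2, Lemma 5.3, Thm. 7.2, Lemma 8.2] -/
theorem kolyvaginPrimitiveAdditive_of_published_of_levelSystems :
    PublishedInputsAdditiveKoly → PublishedDualityInputsAdditiveKoly → LevelKolyvaginSystemsAdditive →
      KolyvaginPrimitiveAdditive :=
  fun hPUB hDual hKS ↦ kolyvaginPrimitiveAdditive_of_levelSystems hPUB hDual hKS

end Summit.BirchSwinnertonDyer.BirchSwinnertonDyer.Theorems.AdditiveKoly

end
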